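import Mathlib

/-!
# BridgePolarization — the ℚ-span of the fourth powers is the whole field (Tier 4, T4-A)

Seat p4 of the blind cell pub-hodge-repro2 (README §6, T4-A). PLAN.md §6.3 (b)(4): the `𝐅`-action on
the split Weil line `W_𝐅(B) = ⋀⁴_𝐅 H¹(B,ℚ)` is realised by algebraic correspondences because the
diagonal endomorphism `[x]` of `B = ∏ A_{Tᵢ}` (`x ∈ 𝒪_𝐅`) acts on the top exterior power `⋀⁴_𝐅` as
multiplication by `x⁴`, and «the ℚ-span of `{x⁴ : x ∈ 𝒪_𝐅}` is `𝐅`». This file proves that sentence by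
the degree-4 polarisation identity (no Vandermonde needed):

  `24 a = −a⁴ + 3 (a+1)⁴ − 3 (a+2)⁴ + (a+3)⁴ − 3·1⁴ + 3·2⁴ − 3⁴`

(the third finite difference of `t ↦ t⁴` at `a` is `24 a + 36`), so every element of a commutative
ℚ-algebra is a ℚ-linear combination of fourth powers (`span_pow_four_eq_top`); the integral version
(`exists_smul_eq_sum_pow_four`) uses only `a, a+1, a+2, a+3, 1, 2, 3`, hence fourth powers of elements
of `𝒪_𝐅` when `a ∈ 𝒪_𝐅`.
-/

namespace Summit.Ventures.HodgeRepro2.BridgePolarization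

section Ring

variable {A : Type*} [CommRing A]

/-- **Degree-4 polarisation identity**: `24 a` is an integral combination of seven fourth powers. -/
theorem polarization_four (a : A) :
    (24 : A) * a = -a ^ 4 + 3 * (a + 1) ^ 4 - 3 * (a + 2) ^ 4 + (a + 3) ^ 4
      - 3 * (1 : A) ^ 4 + 3 * (2 : A) ^ 4 - (3 : A) ^ 4 := by
  ring

/-- Integral form: `24 • a` lies in the ℤ-span of the fourth powers `{x⁴ : x ∈ A}`. -/
theorem smul_mem_span_pow_four (a : A) :
    (24 : ℤ) • a ∈ Submodule.span ℤ (Set.range fun x : A => x ^ 4) := by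
  have h : (24 : ℤ) • a = -a ^ 4 + 3 * (a + 1) ^ 4 - 3 * (a + 2) ^ 4 + (a + 3) ^ 4
      - 3 * (1 : A) ^ 4 + 3 * (2 : A) ^ 4 - (3 : A) ^ 4 := by
    rw [← polarization_four]
    simp
  rw [h]
  have hm : ∀ x : A, x ^ 4 ∈ Submodule.span ℤ (Set.range fun x : A => x ^ 4) :=
    fun x => Submodule.subset_span ⟨x, rfl⟩
  have hz : ∀ (n : ℤ) (x : A), (n : A) * x ^ 4 ∈ Submodule.span ℤ (Set.range fun x : A => x ^ 4) :=
    fun n x => by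
      rw [← zsmul_eq_mul]
      exact Submodule.smul_mem _ n (hm x)
  refine Submodule.sub_mem _ (Submodule.add_mem _ (Submodule.sub_mem _ (Submodule.add_mem _
    (Submodule.sub_mem _ (Submodule.add_mem _ (Submodule.neg_mem _ (hm a)) ?_) ?_) (hm _)) ?_) ?_)
    (hm _)
  · exact_mod_cast hz 3 (a + 1)
  · exact_mod_cast hz 3 (a + 2)
  · exact_mod_cast hz 3 1
  · exact_mod_cast hz 3 2

end Ring

section Algebra

variable {F : Type*} [CommRing F] [Algebra ℚ F]

/-- **The ℚ-span of the fourth powers is everything.** In a commutative ℚ-algebra every element is a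
ℚ-linear combination of fourth powers (PLAN §6.3 (b)(4): the operators `[x]^*|_{W_𝐅(B)} = x⁴` span
the whole `𝐅`-action on the split Weil line). -/
theorem span_pow_four_eq_top :
    Submodule.span ℚ (Set.range fun x : F => x ^ 4) = ⊤ := by
  rw [eq_top_iff]
  intro a _
  have h24 : (24 : ℤ) • a ∈ Submodule.span ℚ (Set.range fun x : F => x ^ 4) := by
    have := smul_mem_span_pow_four a
    exact Submodule.span_le_restrictScalars ℤ ℚ _ this
  have : a = ((1 : ℚ) / 24) • ((24 : ℤ) • a) := by
    rw [← Int.cast_smul_eq_zsmul ℚ, smul_smul]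
    norm_num
  rw [this]
  exact Submodule.smul_mem _ _ h24

/-- Every element of a commutative ℚ-algebra is a ℚ-linear combination of seven explicit fourth
powers (`a, a+1, a+2, a+3, 1, 2, 3`). -/
theorem eq_combination_pow_four (a : F) :
    a = ((1 : ℚ) / 24) • (-a ^ 4 + 3 * (a + 1) ^ 4 - 3 * (a + 2) ^ 4 + (a + 3) ^ 4
      - 3 * (1 : F) ^ 4 + 3 * (2 : F) ^ 4 - (3 : F) ^ 4) := by
  rw [← polarization_four]
  rw [show (24 : F) * a = (24 : ℚ) • a by
    rw [Algebra.smul_def, map_ofNat]]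
  rw [smul_smul]
  norm_num

end Algebra

end Summit.Ventures.HodgeRepro2.BridgePolarization
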